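import Mathlib.RingTheory.Artinian.Module
import Mathlib.FieldTheory.PrimitiveElement
import Mathlib.FieldTheory.Minpoly.Field
import Mathlib.FieldTheory.Minpoly.Finite
import Mathlib.RingTheory.Trace.Basic
import Mathlib.RingTheory.PrincipalIdealDomain
import Mathlib.RingTheory.Coprime.Lemmas
import Mathlib.LinearAlgebra.FiniteDimensional.Basic
import HarnessLib

/-!
# Crux `HodgeAbelianVarieties` (stmt-HodgeConjecture-1333), line `cm-pivot` gen 4 ·
# stub 4 `stub_etalePrimitive`: the primitive element theorem for finite étale `ℚ`-algebras

Route `PadicSemiregularLift`, crux r4; line `cm-pivot`, gen 4 (the CONVERSE CM-typing bridge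
`(∃ S ⊆ End⁰(A) commutative reduced, finrank ℚ S = 2 dim A) ⟹ IsCM[A]`, lead c7). This file proves the
registered stub `stub_etalePrimitive` VERBATIM, unconditionally, from Mathlib only:

* `stub_etalePrimitive` — **a commutative reduced subalgebra `S` of a (possibly non-commutative)
  `ℚ`-algebra with `0 < finrank ℚ S` contains an element `s` with `deg (minpoly ℚ s) = finrank ℚ S`**
  (equivalently `ℚ[s] = S`): the primitive element theorem for finite étale `ℚ`-algebras
  (Bourbaki, *Algèbre* V §7 no. 7 Prop. 13 for fields; folklore for products of fields).

Proof. `S` is finite-dimensional, hence Artinian (`IsArtinianRing.of_finite`), and reduced, so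
`IsArtinianRing.equivPi : S ≃ₐ ∏ᵢ Kᵢ`, a finite product of number fields `Kᵢ = S ⧸ 𝔪ᵢ`
(`exists_natDegree_minpoly_eq_finrank_of_isReduced`). For a finite product of finite extensions `Kᵢ / ℚ`
(`exists_natDegree_minpoly_eq_finrank_pi`): pick primitive elements `xᵢ` (`Field.exists_primitive_element`)
and shift them by rationals, `yᵢ = xᵢ + cᵢ` with `cᵢ = e(i) - Tr(xᵢ)/[Kᵢ : ℚ]` for an injection `e : ι ↪ ℚ`,
so that `Tr_{Kᵢ/ℚ}(yᵢ) / [Kᵢ : ℚ] = e(i)` are pairwise distinct. For a PRIMITIVE element `y` of a finite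
extension `L / ℚ` one has `nextCoeff (minpoly ℚ y) = -Tr_{L/ℚ}(y)` (`nextCoeff_minpoly_eq_neg_trace_of_natDegree_eq`,
from Mathlib's `trace_eq_finrank_mul_minpoly_nextCoeff` and the tower law), so two of the monic irreducible
`minpoly ℚ yᵢ` that coincide have the same degree `[Kᵢ : ℚ] = [Kⱼ : ℚ]` and the same next-to-leading
coefficient `-[Kᵢ : ℚ] e(i) = -[Kⱼ : ℚ] e(j)`, whence `i = j`. Pairwise distinct monic irreducibles are
pairwise coprime, so `∏ᵢ minpoly ℚ yᵢ ∣ minpoly ℚ y` for `y = (yᵢ)ᵢ` (`aeval` is componentwise), giving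
`finrank ℚ (∏ Kᵢ) = ∑ᵢ [Kᵢ : ℚ] ≤ deg minpoly ℚ y ≤ finrank ℚ (∏ Kᵢ)` (`minpoly.natDegree_le`). The subalgebra
form follows by putting the commutative ring structure `hcomm` on `↥S` and `minpoly ℚ (s : C) = minpoly ℚ s`
(`minpoly.algHom_eq S.val`). Mathlib only; no `sorry`, no definition, no hypothesis beyond the registered
signature. Consumer: the lead's composition `isCM_of_cmSubalgebra_of_stubs`
(`Theorems/…CMPivotConverse.lean`). References: Bourbaki, *Algèbre* V §7; [MumfordAV1970] §19 (where the
statement is used for `End⁰(A)`); folklore.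
-/

set_option linter.dupNamespace false

noncomputable section

open Polynomial Module
open scoped IntermediateField

namespace Summit.HodgeConjecture.HodgeConjecture.Theorems.HodgeAbelianVarieties.CMPivot

/-! ### Primitive elements: next-to-leading coefficient of the minimal polynomial = minus the trace -/

/-- **For a primitive element `y` of a finite extension `L / ℚ` (i.e. `deg minpoly ℚ y = [L : ℚ]`),
`nextCoeff (minpoly ℚ y) = -Tr_{L/ℚ}(y)`**: Mathlib's `Tr(y) = [L : ℚ(y)] · (-nextCoeff)` and
`[L : ℚ(y)] = 1` by the tower law `[ℚ(y) : ℚ] [L : ℚ(y)] = [L : ℚ]` with `[ℚ(y) : ℚ] = deg minpoly = [L : ℚ]`.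
[folklore] -/
theorem nextCoeff_minpoly_eq_neg_trace_of_natDegree_eq {L : Type*} [Field L] [Algebra ℚ L]
    [FiniteDimensional ℚ L] {y : L} (hy : (minpoly ℚ y).natDegree = finrank ℚ L) :
    ((minpoly ℚ y).nextCoeff : ℚ) = -Algebra.trace ℚ L y := by
  have h1 := trace_eq_finrank_mul_minpoly_nextCoeff ℚ y
  have h2 : finrank ℚ ℚ⟮y⟯ * finrank ℚ⟮y⟯ L = finrank ℚ L := Module.finrank_mul_finrank ℚ ℚ⟮y⟯ L
  rw [IntermediateField.adjoin.finrank (.of_finite ℚ y), hy] at h2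
  have hpos : 0 < finrank ℚ L := finrank_pos
  have h3 : finrank ℚ⟮y⟯ L = 1 := by
    have := h2.trans (mul_one _).symm
    exact Nat.eq_of_mul_eq_mul_left hpos this
  rw [h3] at h1
  simp [h1]

/-! ### The primitive element theorem for a finite product of number fields -/

/-- **Primitive element theorem for a finite product `∏ᵢ Kᵢ` of finite extensions of `ℚ`**: there is
`y = (yᵢ)ᵢ` with `deg minpoly ℚ y = finrank ℚ (∏ᵢ Kᵢ) = ∑ᵢ [Kᵢ : ℚ]`. Take `yᵢ = xᵢ + cᵢ` with `xᵢ`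
primitive in `Kᵢ` and rational shifts `cᵢ = e(i) - Tr(xᵢ)/[Kᵢ : ℚ]` (`e : ι ↪ ℚ`), so that
`Tr(yᵢ)/[Kᵢ : ℚ] = e(i)`; then the monic irreducible `minpoly ℚ yᵢ` (of degree `[Kᵢ : ℚ]` and
next-to-leading coefficient `-[Kᵢ : ℚ] e(i)`) are pairwise distinct, hence pairwise coprime, hence their
product (of degree `∑ᵢ [Kᵢ : ℚ]`) divides `minpoly ℚ y`, whose degree is at most `finrank ℚ (∏ᵢ Kᵢ)`.
[folklore] -/
theorem exists_natDegree_minpoly_eq_finrank_pi {ι : Type*} [Fintype ι] (K : ι → Type*)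
    [∀ i, Field (K i)] [∀ i, Algebra ℚ (K i)] [∀ i, FiniteDimensional ℚ (K i)] :
    ∃ s : (Π i, K i), (minpoly ℚ s).natDegree = finrank ℚ (Π i, K i) := by
  classical
  have hprim : ∀ i, ∃ x : K i, ℚ⟮x⟯ = ⊤ := fun i => Field.exists_primitive_element ℚ (K i)
  choose x hx using hprim
  -- an injection `ι → ℚ`
  let e : ι → ℚ := fun i => ((Fintype.equivFin ι i : ℕ) : ℚ)
  have he : Function.Injective e := by
    intro i j hij
    have hij' : ((Fintype.equivFin ι i : ℕ) : ℚ) = (Fintype.equivFin ι j : ℕ) := hij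
    exact (Fintype.equivFin ι).injective (Fin.ext (by exact_mod_cast hij'))
  -- rational shifts making the normalised traces pairwise distinct
  let c : ι → ℚ := fun i => e i - Algebra.trace ℚ (K i) (x i) / finrank ℚ (K i)
  let y : Π i, K i := fun i => x i + algebraMap ℚ (K i) (c i)
  have hn : ∀ i, (finrank ℚ (K i) : ℚ) ≠ 0 := fun i => by exact_mod_cast finrank_pos.ne'
  have hdeg : ∀ i, (minpoly ℚ (y i)).natDegree = finrank ℚ (K i) := by
    intro i
    change (minpoly ℚ (x i + algebraMap ℚ (K i) (c i))).natDegree = _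
    rw [minpoly.add_algebraMap, natDegree_comp, natDegree_X_sub_C, mul_one]
    exact (Field.primitive_element_iff_minpoly_natDegree_eq ℚ (x i)).mp (hx i)
  have htr : ∀ i, Algebra.trace ℚ (K i) (y i) = finrank ℚ (K i) * e i := by
    intro i
    change Algebra.trace ℚ (K i) (x i + algebraMap ℚ (K i) (c i)) = _
    have hn' := hn i
    rw [map_add, Algebra.trace_algebraMap, nsmul_eq_mul]
    simp only [c]
    field_simp
    ring
  have hnext : ∀ i, (minpoly ℚ (y i)).nextCoeff = -(finrank ℚ (K i) * e i) := fun i => by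
    rw [nextCoeff_minpoly_eq_neg_trace_of_natDegree_eq (hdeg i), htr]
  -- the minimal polynomials of the `y i` are pairwise distinct
  have hne : ∀ i j, i ≠ j → minpoly ℚ (y i) ≠ minpoly ℚ (y j) := by
    intro i j hij h
    apply hij
    apply he
    have hd : (finrank ℚ (K i) : ℚ) = finrank ℚ (K j) := by
      exact_mod_cast (hdeg i).symm.trans ((congrArg natDegree h).trans (hdeg j))
    have hc : (minpoly ℚ (y i)).nextCoeff = (minpoly ℚ (y j)).nextCoeff := by rw [h]
    rw [hnext i, hnext j, ← hd, neg_inj] at hc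
    exact mul_left_cancel₀ (hn i) hc
  have hint : ∀ i, IsIntegral ℚ (y i) := fun i => .of_finite ℚ (y i)
  have hirr : ∀ i, Irreducible (minpoly ℚ (y i)) := fun i => minpoly.irreducible (hint i)
  have hmonic : ∀ i, (minpoly ℚ (y i)).Monic := fun i => minpoly.monic (hint i)
  -- hence pairwise coprime
  have hcop : Pairwise (Function.onFun IsCoprime fun i => minpoly ℚ (y i)) := by
    intro i j hij
    dsimp only [Function.onFun]
    rw [(hirr i).coprime_iff_not_dvd]
    intro hdvd
    exact hne i j hij (eq_of_monic_of_associated (hmonic i) (hmonic j)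
      (((hirr i).dvd_irreducible_iff_associated (hirr j)).mp hdvd))
  -- so their product divides the minimal polynomial of `y`
  have hyint : IsIntegral ℚ y := .of_finite ℚ y
  have hPdvd : (∏ i, minpoly ℚ (y i)) ∣ minpoly ℚ y := by
    refine Fintype.prod_dvd_of_coprime hcop fun i => minpoly.dvd ℚ (y i) ?_
    rw [← aeval_pi_apply₂ y (minpoly ℚ y) i, minpoly.aeval, Pi.zero_apply]
  have hPdeg : (∏ i, minpoly ℚ (y i)).natDegree = finrank ℚ (Π i, K i) := by
    rw [natDegree_prod_of_monic _ _ (fun i _ => hmonic i), finrank_pi_fintype]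
    exact Finset.sum_congr rfl fun i _ => hdeg i
  have h1 : (∏ i, minpoly ℚ (y i)).natDegree ≤ (minpoly ℚ y).natDegree :=
    natDegree_le_of_dvd hPdvd (minpoly.ne_zero hyint)
  have h2 : (minpoly ℚ y).natDegree ≤ finrank ℚ (Π i, K i) := minpoly.natDegree_le y
  exact ⟨y, le_antisymm h2 (hPdeg ▸ h1)⟩

/-! ### Finite étale `ℚ`-algebras -/

/-- **Primitive element theorem for finite étale `ℚ`-algebras**: a non-trivial commutative reduced
finite-dimensional `ℚ`-algebra `S` contains `s` with `deg minpoly ℚ s = finrank ℚ S`. Indeed `S` is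
Artinian and reduced, so `S ≃ₐ[ℚ] ∏_𝔪 S ⧸ 𝔪` over its finitely many maximal ideals
(`IsArtinianRing.equivPi`), a finite product of finite field extensions of `ℚ`; apply
`exists_natDegree_minpoly_eq_finrank_pi` and transport along the algebra isomorphism. [folklore] -/
theorem exists_natDegree_minpoly_eq_finrank_of_isReduced (S : Type*) [CommRing S] [Algebra ℚ S]
    [IsReduced S] [Module.Finite ℚ S] [Nontrivial S] :
    ∃ s : S, (minpoly ℚ s).natDegree = finrank ℚ S := by
  haveI : IsArtinianRing S := IsArtinianRing.of_finite ℚ S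
  letI : ∀ I : MaximalSpectrum S, Field (S ⧸ I.asIdeal) := fun I => Ideal.Quotient.field I.asIdeal
  haveI : Fintype (MaximalSpectrum S) := Fintype.ofFinite _
  let e : S ≃ₐ[ℚ] (Π I : MaximalSpectrum S, S ⧸ I.asIdeal) :=
    (IsArtinianRing.equivPi S).restrictScalars ℚ
  obtain ⟨t, ht⟩ :=
    exists_natDegree_minpoly_eq_finrank_pi (fun I : MaximalSpectrum S => S ⧸ I.asIdeal)
  refine ⟨e.symm t, ?_⟩
  rw [minpoly.algEquiv_eq e.symm t, ht, e.toLinearEquiv.finrank_eq]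

/-- STUB 4 of line `cm-pivot` gen 4 (registered signature, verbatim) — **a commutative reduced subalgebra
`S` of a (possibly non-commutative) `ℚ`-algebra `C` with `0 < finrank ℚ S` contains an element `s` whose
minimal polynomial over `ℚ` has degree `finrank ℚ S`** (primitive element theorem for finite étale
`ℚ`-algebras). `0 < finrank` makes `↥S` finite-dimensional and non-trivial; `hcomm` makes `↥S` a commutative
ring (same underlying ring structure), to which `exists_natDegree_minpoly_eq_finrank_of_isReduced` applies;
finally `minpoly ℚ (s : C) = minpoly ℚ s` along the injective `S.val` (`minpoly.algHom_eq`). [folklore] -/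
theorem stub_etalePrimitive {C : Type*} [Ring C] [Algebra ℚ C] (S : Subalgebra ℚ C)
    (hred : IsReduced ↥S) (hcomm : ∀ x ∈ S, ∀ y ∈ S, x * y = y * x)
    (hfin : 0 < Module.finrank ℚ ↥S) :
    ∃ s ∈ S, (minpoly ℚ s).natDegree = Module.finrank ℚ ↥S := by
  letI : CommRing ↥S :=
    { (inferInstance : Ring ↥S) with mul_comm := fun x y => Subtype.ext (hcomm x.1 x.2 y.1 y.2) }
  haveI : Module.Finite ℚ ↥S := Module.finite_of_finrank_pos hfin
  haveI : Nontrivial ↥S := Module.nontrivial_of_finrank_pos hfin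
  obtain ⟨s, hs⟩ := exists_natDegree_minpoly_eq_finrank_of_isReduced ↥S
  refine ⟨s, s.2, ?_⟩
  have h1 : minpoly ℚ (s : C) = minpoly ℚ s := minpoly.algHom_eq S.val Subtype.coe_injective s
  rw [h1]
  exact hs

end Summit.HodgeConjecture.HodgeConjecture.Theorems.HodgeAbelianVarieties.CMPivot

end
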